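import Summits.PneNP.PneNP.Theorems.ChebyshevTracialDesignGammaDirectionCriterion
import HarnessLib

/-!
# Cell pnp-psdrank, route `ChebyshevTracialDesign`: the γ-direction, CONDITIONAL FORM — (ii)+(iii) ⇒ the tilted (CG_1′) value in every
# type-constant direction is at most pure remainders plus the law's tail mass (crux `TracialDecayExp20`, stmt-PneNP-19878)

Brick 134 (prover g26; MEMO-29 §4(b)). Brick 129: `| value + N^{odd}_D[Φ](0) | ≤ R₁₂₀ + R₇ + 12R′`; brick 130: under the centred-basis
relative-smoothness hypotheses (i)–(iii) on a window `B`, `N^{odd}_D[Φ](0) ≥ −2^{D+1}G(2n+3t)²·(law tail outside B)`. Hence, for `0 ≤ ψ ≤ G`: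

* **`gammaDirection_value_le_of_centred`**: `|PM|·Σ_U W(U,M)·ψ(|U∩H|)·(Σ_p u_p x_p x_{πp})² ≤ R₁₂₀ + R₇ + 12R′ + 2^{D+1}·G·(2n+3t)²·Σ_{x∈[0,t]∖B} Σ_{j≤D} law_{2j+1}(x)`
  for EVERY `|γ|,|λ|,|κ| ≤ 1` — the exact shape brick 124 had in the crossing plane before its asymptotic massaging (bricks 125/126): the
  `x`-smoothness family is discharged by brick 132, the remainders are `poly(t,D,B_v)·G·Ξ` (126a-type majorisation), the law tail is
  Literature `ShellLawTail`; what is GENUINELY open is (ii) (and the variance floor making (iii) quantitative, brick 133).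
WHAT THIS FILE DOES NOT DO: prove (ii)/(iii), the asymptotic massaging, the `M`-average, anything on `TracialDecayExp20` itself, psd rank of
P_PM(K_n), or P vs NP.
[cite: Rothvoss2017, §2 (PDF p. 6)] [cite: Agarwal2000DifferenceEquations, Thm. 1.8.5 (1.8.6), Remark 1.8.1 (1.8.8)]
[cite: GriblingDelaatLaurent2019, §5]
Stature: support/instrument (kernel lane, no defs, axioms standard). Supports stmt-PneNP-19878.
-/

set_option linter.dupNamespace false -- `Summit.PneNP.PneNP.…`: summit = sub-problem (D-0017)

noncomputable section

namespace Summit.PneNP.PneNP.Theorems.ChebyshevTracialDesignGammaDirectionConditional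

open Finset Polynomial Literature.Barriers.PneNP Literature.Combinatorics.Optimization
open Literature.Combinatorics.Optimization.ShellStep
open Summit.PneNP.PneNP.Theorems.ChebyshevTracialDesignGammaDirectionReduction (abs_gammaDirection_value_add_newton_le)
open Summit.PneNP.PneNP.Theorems.ChebyshevTracialDesignGammaDirectionCriterion (gammaProfile_newton_eval_zero_ge_of_centred)

variable {n : ℕ}

/-- **THE γ-DIRECTION, CONDITIONAL ON THE CENTRED-MOMENT [BULK] (brick 134).** Hypotheses: brick 129's (exact design, `2(D+1)+4 ≤ t`, `T+4 ≤ t`,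
`2D+1 ≤ T`, matching `M`, block `H`, `0 ≤ ψ ≤ G` on `[0,t]`, `|γ|,|λ|,|κ| ≤ 1`, `m ≥ 3`, `m+4(D+1)+4 ≤ n`, the extended `x`-smoothness family `X_k`) and
brick 130's (window `B ⊆ [0,t]`, centring `m(x)` with `B^m_1(x) = 0`, relative level-smoothness of `A^m_·(x)`, `B^m_·(x)`, `law_·(x)` with
`ε_A+ε_B ≤ 1`, `ε_C+ε_B ≤ 1`). Conclusion:
`|PM|·Σ_U W(U,M)·ψ(|U∩H|)·(Σ_p u_p x_p x_{πp})² ≤ R₁₂₀ + R₇ + 12R′ + 2^{D+1}·G·(2n+3t)²·Σ_{x∈[0,t]∖B} Σ_{j≤D} law_{2j+1}(x)`.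
[cite: Rothvoss2017, §2 (PDF p. 6)] [cite: Agarwal2000DifferenceEquations, Thm. 1.8.5 (1.8.6), Remark 1.8.1 (1.8.8)] -/
theorem gammaDirection_value_le_of_centred {t T D : ℕ} {Bv : ℝ} {C : Finset ℕ} {w : ℕ → ℝ}
    (hdes : IsExactDesign n t T D Bv C w) (hDT : 2 * D + 1 ≤ T) (hT4 : T + 4 ≤ t) (h4t : 2 * (D + 1) + 4 ≤ t)
    (M : PMatch n) (H : Finset (Fin n)) (ψ : ℤ → ℝ) {G : ℝ} (hG0 : 0 ≤ G)
    (hψ0 : ∀ x ∈ Icc (0 : ℤ) (t : ℤ), 0 ≤ ψ x) (hψG : ∀ x ∈ Icc (0 : ℤ) (t : ℤ), ψ x ≤ G)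
    (gam lam kap : ℝ) (hgam : |gam| ≤ 1) (hlam : |lam| ≤ 1) (hkap : |kap| ≤ 1)
    {m : ℕ} (hm : 3 ≤ m) (hmn : m + 4 * (D + 1) + 4 ≤ n) (X : ℕ → ℝ) (hX0 : ∀ k, 0 ≤ X k)
    (hX : ∀ k, k ≤ D + 1 → ∀ r s : ℕ, r ≤ 2 → r ≤ s → s ≤ 2 * r → ∀ c' : ℕ, c' + 2 * k ≤ T →
      ∀ S' : Finset (Fin n), (∀ u ∈ S', M.2.partner u ∈ S') → S'.card + 4 * k + 2 * r = n →
      ∑ x ∈ Icc (0 : ℤ) ((t - s : ℕ) : ℤ),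
        |nab2^[k] (fun c x => shellLaw M.2.partner S' H (t - s - 2 * k) c x : Profile) c' x| ≤ X k)
    (B : Finset ℤ) (hB : B ⊆ Icc (0 : ℤ) t) (mf : ℤ → ℝ) {εA εB εC : ℝ} (hεB : 0 ≤ εB) (h1 : εA + εB ≤ 1) (h2 : εC + εB ≤ 1)
    (hcentre : ∀ x ∈ B, ((∑ U ∈ ((shell M.2.partner t 1).filter fun U => ((U ∩ H).card : ℤ) = x),
          (((((reps M.2.partner (vAA M.2.partner univ H)).filter fun v => v ∈ U ∧ M.2.partner v ∈ U).card : ℕ) : ℝ) - mf x)) /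
          ((shell M.2.partner t 1).card : ℝ)) = 0)
    (hA : ∀ x ∈ B, ∑ k ∈ Ico 1 (D + 1), (((2 * k).choose k : ℕ) : ℝ) / (4 : ℝ) ^ k *
        |(fwdDiff (1 : ℕ))^[k] (fun j => ((∑ U ∈ ((shell M.2.partner t (2 * j + 1)).filter fun U => ((U ∩ H).card : ℤ) = x),
          (((((reps M.2.partner (vAA M.2.partner univ H)).filter fun v => v ∈ U ∧ M.2.partner v ∈ U).card : ℕ) : ℝ) - mf x) ^ 2) /
          ((shell M.2.partner t (2 * j + 1)).card : ℝ))) 0| ≤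
      εA * ((∑ U ∈ ((shell M.2.partner t 1).filter fun U => ((U ∩ H).card : ℤ) = x),
          (((((reps M.2.partner (vAA M.2.partner univ H)).filter fun v => v ∈ U ∧ M.2.partner v ∈ U).card : ℕ) : ℝ) - mf x) ^ 2) /
          ((shell M.2.partner t 1).card : ℝ)))
    (hBm : ∀ x ∈ B, ∑ k ∈ Ico 1 (D + 1), (((2 * k).choose k : ℕ) : ℝ) / (4 : ℝ) ^ k *
        |(fwdDiff (1 : ℕ))^[k] (fun j => ((∑ U ∈ ((shell M.2.partner t (2 * j + 1)).filter fun U => ((U ∩ H).card : ℤ) = x),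
          (((((reps M.2.partner (vAA M.2.partner univ H)).filter fun v => v ∈ U ∧ M.2.partner v ∈ U).card : ℕ) : ℝ) - mf x)) /
          ((shell M.2.partner t (2 * j + 1)).card : ℝ))) 0| ≤
      εB * Real.sqrt (((∑ U ∈ ((shell M.2.partner t 1).filter fun U => ((U ∩ H).card : ℤ) = x),
          (((((reps M.2.partner (vAA M.2.partner univ H)).filter fun v => v ∈ U ∧ M.2.partner v ∈ U).card : ℕ) : ℝ) - mf x) ^ 2) /
          ((shell M.2.partner t 1).card : ℝ)) * shellLaw M.2.partner univ H t 1 x))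
    (hC : ∀ x ∈ B, ∑ k ∈ Ico 1 (D + 1), (((2 * k).choose k : ℕ) : ℝ) / (4 : ℝ) ^ k *
        |(fwdDiff (1 : ℕ))^[k] (fun j => shellLaw M.2.partner univ H t (2 * j + 1) x) 0| ≤ εC * shellLaw M.2.partner univ H t 1 x) :
    (Fintype.card (PMatch n) : ℝ) * ∑ U : OddSet n, levelWeight n t C w U M *
        (ψ ((U.1 ∩ H).card : ℤ) *
          (∑ p : Fin n, (gam * (if (p ∈ H ∧ M.2.partner p ∈ H) then (1 : ℝ) else 0) +
              (lam * ((if (p ∈ H ∧ M.2.partner p ∈ H) then (1 : ℝ) else 0) -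
                (if (p ∉ H ∧ M.2.partner p ∉ H) then (1 : ℝ) else 0)) + (lam + kap))) *
            ((if p ∈ U.1 then (1 : ℝ) else 0) * (if M.2.partner p ∈ U.1 then (1 : ℝ) else 0))) ^ 2) ≤
      -- R₁₂₀ (brick 120)
      (-- R₀
      Bv * ((((T - 1) / 2).choose (D + 1) : ℕ) : ℝ) *
          ((9 * (t : ℝ) ^ 2 * G) * (((m : ℝ) / (4 * ((m : ℝ) - 2))) ^ (D + 1) * X (D + 1))) +
      -- 2 R₁
      2 * ((2 * (D : ℝ) + 1) * ((((2 * D).choose D : ℕ) : ℝ) / (4 : ℝ) ^ D) *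
            ((3 * (t : ℝ) * G) * (((m : ℝ) / (4 * ((m : ℝ) - 2))) ^ D * X D)) +
          Bv * ((((T - 1) / 2).choose (D + 1) : ℕ) : ℝ) *
            ((T : ℝ) * ((3 * (t : ℝ) * G) * (((m : ℝ) / (4 * ((m : ℝ) - 2))) ^ (D + 1) * X (D + 1))) +
              2 * ((D : ℝ) + 1) * ((3 * (t : ℝ) * G) * (((m : ℝ) / (4 * ((m : ℝ) - 2))) ^ D * X D)))) +
      -- R₂
      ((2 * (D : ℝ) + 1) * ((((2 * D).choose D : ℕ) : ℝ) / (4 : ℝ) ^ D) *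
          ((T : ℝ) * (G * (((m : ℝ) / (4 * ((m : ℝ) - 2))) ^ D * X D)) +
            2 * (D : ℝ) * (G * (((m : ℝ) / (4 * ((m : ℝ) - 2))) ^ (D - 1) * X (D - 1)))) +
        Bv * ((((T - 1) / 2).choose (D + 1) : ℕ) : ℝ) *
          ((T : ℝ) * ((T : ℝ) * (G * (((m : ℝ) / (4 * ((m : ℝ) - 2))) ^ (D + 1) * X (D + 1))) +
              2 * ((D : ℝ) + 1) * (G * (((m : ℝ) / (4 * ((m : ℝ) - 2))) ^ D * X D))) +
            2 * ((D : ℝ) + 1) * ((T : ℝ) * (G * (((m : ℝ) / (4 * ((m : ℝ) - 2))) ^ D * X D)) +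
              2 * (D : ℝ) * (G * (((m : ℝ) / (4 * ((m : ℝ) - 2))) ^ (D - 1) * X (D - 1)))))) +
      -- 4 R₃
      4 * ((2 * (D : ℝ) + 1) * ((((2 * D).choose D : ℕ) : ℝ) / (4 : ℝ) ^ D) *
            (((H.card : ℝ) / n) * ((3 * (t : ℝ) * G) * (((m : ℝ) / (4 * ((m : ℝ) - 2))) ^ D * X D))) +
          Bv * ((((T - 1) / 2).choose (D + 1) : ℕ) : ℝ) *
            ((T : ℝ) * (((H.card : ℝ) / n) * ((3 * (t : ℝ) * G) *
                (((m : ℝ) / (4 * ((m : ℝ) - 2))) ^ (D + 1) * X (D + 1)))) +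
              2 * ((D : ℝ) + 1) * (((H.card : ℝ) / n) * ((3 * (t : ℝ) * G) *
                (((m : ℝ) / (4 * ((m : ℝ) - 2))) ^ D * X D))))) +
      -- 4 R₄
      4 * ((2 * (D : ℝ) + 1) * ((((2 * D).choose D : ℕ) : ℝ) / (4 : ℝ) ^ D) *
            ((T : ℝ) * (((H.card : ℝ) / n) * (G * (((m : ℝ) / (4 * ((m : ℝ) - 2))) ^ D * X D))) +
              2 * (D : ℝ) * (((H.card : ℝ) / n) * (G * (((m : ℝ) / (4 * ((m : ℝ) - 2))) ^ (D - 1) * X (D - 1))))) +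
          Bv * ((((T - 1) / 2).choose (D + 1) : ℕ) : ℝ) *
            ((T : ℝ) * ((T : ℝ) * (((H.card : ℝ) / n) * (G * (((m : ℝ) / (4 * ((m : ℝ) - 2))) ^ (D + 1) * X (D + 1)))) +
                2 * ((D : ℝ) + 1) * (((H.card : ℝ) / n) * (G * (((m : ℝ) / (4 * ((m : ℝ) - 2))) ^ D * X D)))) +
              2 * ((D : ℝ) + 1) * ((T : ℝ) * (((H.card : ℝ) / n) * (G * (((m : ℝ) / (4 * ((m : ℝ) - 2))) ^ D * X D))) +
                2 * (D : ℝ) * (((H.card : ℝ) / n) * (G * (((m : ℝ) / (4 * ((m : ℝ) - 2))) ^ (D - 1) * X (D - 1))))))) +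
      -- 4 R₅
      4 * ((2 * (D : ℝ) + 1) * ((((2 * D).choose D : ℕ) : ℝ) / (4 : ℝ) ^ D) *
            (((H.card : ℝ) / n) * (G * (((m : ℝ) / (4 * ((m : ℝ) - 2))) ^ D * X D))) +
          Bv * ((((T - 1) / 2).choose (D + 1) : ℕ) : ℝ) *
            ((T : ℝ) * (((H.card : ℝ) / n) * (G * (((m : ℝ) / (4 * ((m : ℝ) - 2))) ^ (D + 1) * X (D + 1)))) +
              2 * ((D : ℝ) + 1) * (((H.card : ℝ) / n) * (G * (((m : ℝ) / (4 * ((m : ℝ) - 2))) ^ D * X D))))) +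
      -- 4 R₆
      4 * ((2 * (D : ℝ) + 1) * ((((2 * D).choose D : ℕ) : ℝ) / (4 : ℝ) ^ D) *
            (((H.card : ℝ) ^ 2 / ((n : ℝ) * ((n : ℝ) - 2))) * (G * ((T : ℝ) * (((m : ℝ) / (4 * ((m : ℝ) - 2))) ^ D * X D) +
              2 * (D : ℝ) * (((m : ℝ) / (4 * ((m : ℝ) - 2))) ^ (D - 1) * X (D - 1))))) +
          Bv * ((((T - 1) / 2).choose (D + 1) : ℕ) : ℝ) *
            ((T : ℝ) * (((H.card : ℝ) ^ 2 / ((n : ℝ) * ((n : ℝ) - 2))) *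
                (G * ((T : ℝ) * (((m : ℝ) / (4 * ((m : ℝ) - 2))) ^ (D + 1) * X (D + 1)) +
                  2 * ((D : ℝ) + 1) * (((m : ℝ) / (4 * ((m : ℝ) - 2))) ^ D * X D)))) +
              2 * ((D : ℝ) + 1) * (((H.card : ℝ) ^ 2 / ((n : ℝ) * ((n : ℝ) - 2))) *
                (G * ((T : ℝ) * (((m : ℝ) / (4 * ((m : ℝ) - 2))) ^ D * X D) +
                  2 * (D : ℝ) * (((m : ℝ) / (4 * ((m : ℝ) - 2))) ^ (D - 1) * X (D - 1)))))))) +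
      -- R₇ (brick 129c with G₂ = 16tG, |α| ≤ 4)
      Bv * ((((T - 1) / 2).choose (D + 1) : ℕ) : ℝ) *
        (16 * (t : ℝ) * G * ((t : ℝ) * (((m : ℝ) / (4 * ((m : ℝ) - 2))) ^ (D + 1) * X (D + 1)) + 2 * ((D : ℝ) + 1) * (((m : ℝ) / (4 * ((m : ℝ) - 2))) ^ D * X D)) +
          4 * (G * ((t : ℝ) * ((t : ℝ) * (((m : ℝ) / (4 * ((m : ℝ) - 2))) ^ (D + 1) * X (D + 1)) + 2 * ((D : ℝ) + 1) * (((m : ℝ) / (4 * ((m : ℝ) - 2))) ^ D * X D)) +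
            2 * ((D : ℝ) + 1) * ((t : ℝ) * (((m : ℝ) / (4 * ((m : ℝ) - 2))) ^ D * X D) + 2 * (D : ℝ) * (((m : ℝ) / (4 * ((m : ℝ) - 2))) ^ (D - 1) * X (D - 1)))))) +
      -- 12 R′ (bricks 129b)
      12 * ((2 * (D : ℝ) + 1) * ((((2 * D).choose D : ℕ) : ℝ) / (4 : ℝ) ^ D) *
          ((t : ℝ) * (G * (((m : ℝ) / (4 * ((m : ℝ) - 2))) ^ D * X D)) +
            2 * (D : ℝ) * (G * (((m : ℝ) / (4 * ((m : ℝ) - 2))) ^ (D - 1) * X (D - 1)))) +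
        Bv * ((((T - 1) / 2).choose (D + 1) : ℕ) : ℝ) *
          ((T : ℝ) * ((t : ℝ) * (G * (((m : ℝ) / (4 * ((m : ℝ) - 2))) ^ (D + 1) * X (D + 1))) +
              2 * ((D : ℝ) + 1) * (G * (((m : ℝ) / (4 * ((m : ℝ) - 2))) ^ D * X D))) +
            2 * ((D : ℝ) + 1) * ((t : ℝ) * (G * (((m : ℝ) / (4 * ((m : ℝ) - 2))) ^ D * X D)) +
              2 * (D : ℝ) * (G * (((m : ℝ) / (4 * ((m : ℝ) - 2))) ^ (D - 1) * X (D - 1)))))) +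
      ((2 : ℝ) ^ (D + 1) * G * (2 * (n : ℝ) + 3 * (t : ℝ)) ^ 2 *
        ∑ x ∈ Icc (0 : ℤ) t \ B, ∑ j ∈ range (D + 1), shellLaw M.2.partner univ H t (2 * j + 1) x) := by
  have hG : ∀ x ∈ Icc (0 : ℤ) (t : ℤ), |ψ x| ≤ G := fun x hx => by
    rw [abs_of_nonneg (hψ0 x hx)]; exact hψG x hx
  have h129 := abs_gammaDirection_value_add_newton_le hdes hDT hT4 h4t M H ψ hG0 hG gam lam kap hgam hlam hkap hm hmn X hX0 hX
  have h130 := gammaProfile_newton_eval_zero_ge_of_centred D t M H ψ hψ0 hψG hgam hlam hkap B hB mf hεB h1 h2 hcentre hA hBm hC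
  have h := (abs_le.1 h129).2
  linarith

end Summit.PneNP.PneNP.Theorems.ChebyshevTracialDesignGammaDirectionConditional

end
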